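import Mathlib
import HarnessLib.Audit
import Summits.PneNP.PneNP.Theorems.PstarGateNodesX
import Summits.PneNP.PneNP.Theorems.PstarGateCasePNorHolders

/-!
# One GATED chord: the global budget with one extra CROSS gate (E2; prover-1 g19)

FRONTIER range-avoidance ladder, rung F-N3 (`stmt-PneNP-19007`), cell `pnp-ideate` (`PstarGateNodesX`); restricted-model proof complexity —
nothing here bears on `P` versus `NP`.

The boundary count of `PstarGateBudget.gate_budget` on `X = J₀ ∪ {g₀, o}` for a further pendant gate `o ∉ J₀` both of whose AND variables are
read inside `J₀` (a "cross gate"): `o` pays at most its two XOR slots, so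

* `gate_budget_cross` — **`#(J₀ ∖ N) ≤ #N + 2·#Pv`**, `Pv` = the tree edges both of whose AND variables are private within `J₀ ∪ {g₀, o}`.
-/

set_option linter.dupNamespace false -- `Summit.PneNP.PneNP.…`: summit = sub-problem name (D-0017 single-conjunct layout)

open Finset Literature.Computability.Complexity
open Summit.PneNP.PneNP.Theorems.PstarSALevel (varSet bdry BoundaryExpanding SimpleOverlap)
open Summit.PneNP.PneNP.Theorems.PstarCentreFree (vars_mem_varSet)
open Summit.PneNP.PneNP.Theorems.PstarXCore (xverts)
open Summit.PneNP.PneNP.Theorems.PstarCoreBound (XorClosed)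
open Summit.PneNP.PneNP.Theorems.PstarChordSystem (ChordSystem)
open Summit.PneNP.PneNP.Theorems.PstarChordBridgeTools (privs coef)
open Summit.PneNP.PneNP.Theorems.PstarChordBridge (BridgeData sys Solution Lift)
open Summit.PneNP.PneNP.Theorems.PstarNorCoreTools (not_mem_bdry_of_two card_varSet_inter_bdry_le card_bdry_le_sum)
open Summit.PneNP.PneNP.Theorems.PstarGateBridge (GateHyp)
open Summit.PneNP.PneNP.Theorems.PstarGateCasePNorHolders (not_mem_bdry_of_closed card_three_slots)
open Summit.PneNP.PneNP.Theorems.PstarGateNodes (GateData)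
open Summit.PneNP.PneNP.Theorems.PstarGateNodesX (GateDataX)

namespace Summit.PneNP.PneNP.Theorems.PstarGateBudgetCross

variable {n m : ℕ}

/-- **The global budget with a cross gate.**  See the module docstring. -/
theorem gate_budget_cross (I : LocalMap 4 n m) {r₀ : ℕ} (hB : BoundaryExpanding r₀ I) {B : BridgeData n m} {e g₀ : Fin m}
    {u : Fin n} {κ₀ : ZMod 2} (hD : GateDataX I r₀ B e g₀ u κ₀) {o : Fin m} (ho : o ∈ B.G₁ ∪ B.G₂) (hoJ : o ∉ B.J₀) (hog : o ≠ g₀)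
    (hold2 : ∃ j ∈ B.J₀, I.vars o 2 ∈ varSet I j) (hold3 : ∃ j ∈ B.J₀, I.vars o 3 ∈ varSet I j) :
    ∃ Pv ⊆ B.J₀ \ B.N,
      (∀ j ∈ Pv, ∀ j' ∈ insert o (insert g₀ B.J₀), j' ≠ j → I.vars j 2 ∉ varSet I j' ∧ I.vars j 3 ∉ varSet I j') ∧
      (B.J₀ \ B.N).card ≤ B.N.card + 2 * Pv.card := by
  classical
  obtain ⟨hXc, hW, hr, hd₁, -, -, -, -, hG, hg₀, hgv, hju, -⟩ := id hD
  have he : e ∈ B.N := hG.1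
  have heJ : e ∈ B.J₀ := hW.hN he
  have hg₀J : g₀ ∉ B.J₀ := fun h => disjoint_left.1 hd₁ hg₀ h
  set F := B.J₀ \ B.N with hFdef
  have hFJ : F ⊆ B.J₀ := sdiff_subset
  set X : Finset (Fin m) := insert o (insert g₀ B.J₀) with hXdef
  set Pv := F.filter (fun j => ∀ j' ∈ X, j' ≠ j → I.vars j 2 ∉ varSet I j' ∧ I.vars j 3 ∉ varSet I j') with hPv
  refine ⟨Pv, filter_subset _ _, fun j hj => (mem_filter.1 hj).2, ?_⟩
  have hJX : B.J₀ ⊆ X := (subset_insert _ _).trans (subset_insert _ _)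
  have hg₀X : g₀ ∈ X := mem_insert_of_mem (mem_insert_self _ _)
  have hog₀J : o ∉ insert g₀ B.J₀ := by rw [mem_insert, not_or]; exact ⟨hog, hoJ⟩
  have hXr : X.card ≤ r₀ := by
    refine (card_le_card (insert_subset ?_ (insert_subset (mem_union_left _ (mem_union_right _ hg₀))
      (subset_union_left.trans subset_union_left)))).trans hr
    rcases mem_union.1 ho with h | h
    · exact mem_union_left _ (mem_union_right _ h)
    · exact mem_union_right _ h
  have hXcard : X.card = B.J₀.card + 2 := by rw [hXdef, card_insert_of_notMem hog₀J, card_insert_of_notMem hg₀J]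
  obtain ⟨jᵤ, hjᵤF, hjᵤu⟩ := hju
  have hu_jᵤ : u ∈ varSet I jᵤ := by rcases hjᵤu with h | h <;> rw [h] <;> exact vars_mem_varSet I jᵤ _
  have hp_g₀ : I.vars e 2 ∈ varSet I g₀ := by
    rcases hgv with ⟨h2, -⟩ | ⟨-, h3⟩
    · exact h2 ▸ vars_mem_varSet I g₀ 2
    · exact h3 ▸ vars_mem_varSet I g₀ 3
  -- per-output budgets
  let q : Fin m → ℕ := fun k => if k = o then 2 else if k = g₀ then 2 else if k ∈ B.N.erase e then 2 else if k ∈ Pv then 2 else 1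
  have htwo : ∀ k ∈ X, k ∈ B.J₀ → (varSet I k ∩ bdry I X).card ≤ 2 := by
    intro k hk hkJ
    have h := card_varSet_inter_bdry_le I X k {0, 1} (fun s hs => by
      simp only [mem_insert, mem_singleton] at hs
      rcases hs with rfl | rfl
      · exact not_mem_bdry_of_closed I hXc hJX hkJ (by decide)
      · exact not_mem_bdry_of_closed I hXc hJX hkJ (by decide))
    have h2 : ({0, 1} : Finset (Fin 4)).card = 2 := by decide
    rw [h2] at h; exact h
  have hq : ∀ k ∈ X, (varSet I k ∩ bdry I X).card ≤ q k := by
    intro k hk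
    by_cases hko : k = o
    · subst hko
      simp only [q, if_true]
      obtain ⟨j2, hj2, hv2⟩ := hold2
      obtain ⟨j3, hj3, hv3⟩ := hold3
      have h := card_varSet_inter_bdry_le I X k {2, 3} (fun s hs => by
        simp only [mem_insert, mem_singleton] at hs
        rcases hs with rfl | rfl
        · exact not_mem_bdry_of_two I hk (hJX hj2) (fun h => hoJ (h ▸ hj2)) (vars_mem_varSet I k 2) hv2
        · exact not_mem_bdry_of_two I hk (hJX hj3) (fun h => hoJ (h ▸ hj3)) (vars_mem_varSet I k 3) hv3)
      have h2 : ({2, 3} : Finset (Fin 4)).card = 2 := by decide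
      rw [h2] at h; exact h
    by_cases hkg₀ : k = g₀
    · subst hkg₀
      simp only [q, if_neg hko, if_true]
      have h := card_varSet_inter_bdry_le I X k {2, 3} (fun s hs => by
        simp only [mem_insert, mem_singleton] at hs
        rcases hs with rfl | rfl
        · rcases hgv with ⟨h2, -⟩ | ⟨h2, -⟩
          · exact not_mem_bdry_of_two I hk (hJX heJ) (fun h => hg₀J (h ▸ heJ)) (vars_mem_varSet I k 2) (h2 ▸ vars_mem_varSet I e 2)
          · exact not_mem_bdry_of_two I hk (hJX (hFJ hjᵤF)) (fun h => hg₀J (h ▸ hFJ hjᵤF)) (vars_mem_varSet I k 2) (h2 ▸ hu_jᵤ)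
        · rcases hgv with ⟨-, h3⟩ | ⟨-, h3⟩
          · exact not_mem_bdry_of_two I hk (hJX (hFJ hjᵤF)) (fun h => hg₀J (h ▸ hFJ hjᵤF)) (vars_mem_varSet I k 3) (h3 ▸ hu_jᵤ)
          · exact not_mem_bdry_of_two I hk (hJX heJ) (fun h => hg₀J (h ▸ heJ)) (vars_mem_varSet I k 3) (h3 ▸ vars_mem_varSet I e 2))
      have h2 : ({2, 3} : Finset (Fin 4)).card = 2 := by decide
      rw [h2] at h; exact h
    have hkJ : k ∈ B.J₀ := by
      rw [hXdef, mem_insert, mem_insert] at hk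
      rcases hk with h | h | h
      · exact absurd h hko
      · exact absurd h hkg₀
      · exact h
    by_cases hkN : k ∈ B.N.erase e
    · simp only [q, if_neg hko, if_neg hkg₀, if_pos hkN]
      exact htwo k hk hkJ
    by_cases hkP : k ∈ Pv
    · simp only [q, if_neg hko, if_neg hkg₀, if_neg hkN, if_pos hkP]
      exact htwo k hk hkJ
    · simp only [q, if_neg hko, if_neg hkg₀, if_neg hkN, if_neg hkP]
      -- `e`, or a non-private tree edge: one AND slot held elsewhere
      obtain ⟨s, hs2, k', hk', hne', hv⟩ : ∃ s : Fin 4, 2 ≤ s.val ∧ ∃ k' ∈ X, k' ≠ k ∧ I.vars k s ∈ varSet I k' := by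
        by_cases hke : k = e
        · subst hke
          exact ⟨2, by decide, g₀, hg₀X, fun h => hg₀J (h ▸ heJ), hp_g₀⟩
        have hkF : k ∈ F := mem_sdiff.2 ⟨hkJ, fun hkN' => hkN (mem_erase.2 ⟨hke, hkN'⟩)⟩
        have hnp : ¬ ∀ j' ∈ X, j' ≠ k → I.vars k 2 ∉ varSet I j' ∧ I.vars k 3 ∉ varSet I j' :=
          fun h => hkP (mem_filter.2 ⟨hkF, h⟩)
        push Not at hnp
        obtain ⟨j', hj'X, hj'k, hj'⟩ := hnp
        by_cases h2 : I.vars k 2 ∈ varSet I j'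
        · exact ⟨2, by decide, j', hj'X, hj'k, h2⟩
        · exact ⟨3, by decide, j', hj'X, hj'k, hj' h2⟩
      have h := card_varSet_inter_bdry_le I X k {0, 1, s} (fun s' hs' => by
        simp only [mem_insert, mem_singleton] at hs'
        rcases hs' with rfl | rfl | rfl
        · exact not_mem_bdry_of_closed I hXc hJX hkJ (by decide)
        · exact not_mem_bdry_of_closed I hXc hJX hkJ (by decide)
        · exact not_mem_bdry_of_two I hk hk' (Ne.symm hne') (vars_mem_varSet I k s') hv)
      rw [card_three_slots hs2] at h
      exact h
  have hbd := card_bdry_le_sum I X q hq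
  -- evaluate the sum over `J₀ = N ⊔ F`
  have hqg₀ : q g₀ = 2 := by
    show (if g₀ = o then 2 else if g₀ = g₀ then 2 else if g₀ ∈ B.N.erase e then 2 else if g₀ ∈ Pv then 2 else 1) = 2
    rw [if_neg (Ne.symm hog), if_pos rfl]
  have hJsplit : B.J₀ = B.N ∪ F := by rw [hFdef, union_sdiff_of_subset hW.hN]
  have hdisj : Disjoint B.N F := by rw [hFdef]; exact disjoint_sdiff
  have hsumN : ∑ k ∈ B.N, q k = 1 + 2 * (B.N.erase e).card := by
    rw [← add_sum_erase B.N q he]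
    have heg₀ : e ≠ g₀ := fun h => hg₀J (h ▸ heJ)
    have heP : e ∉ Pv := fun h => (mem_sdiff.1 (mem_filter.1 h).1).2 he
    have hqe : q e = 1 := by
      have heo : e ≠ o := fun h => hoJ (h ▸ heJ)
      show (if e = o then 2 else if e = g₀ then 2 else if e ∈ B.N.erase e then 2 else if e ∈ Pv then 2 else 1) = 1
      rw [if_neg heo, if_neg heg₀, if_neg (notMem_erase e B.N), if_neg heP]
    rw [hqe, mul_comm, card_eq_sum_ones, sum_mul]
    congr 1
    refine sum_congr rfl fun k hk => ?_
    have hkJ : k ∈ B.J₀ := hW.hN (mem_of_mem_erase hk)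
    have hkg₀ : k ≠ g₀ := fun h => hg₀J (h ▸ hkJ)
    have hko : k ≠ o := fun h => hoJ (h ▸ hkJ)
    show (if k = o then 2 else if k = g₀ then 2 else if k ∈ B.N.erase e then 2 else if k ∈ Pv then 2 else 1) = 1 * 2
    rw [if_neg hko, if_neg hkg₀, if_pos hk, one_mul]
  have hsumF : ∑ k ∈ F, q k = F.card + Pv.card := by
    have hsplit := (sum_filter_add_sum_filter_not F (fun k => k ∈ Pv) q).symm
    have hf1 : F.filter (fun k => k ∈ Pv) = Pv := by
      ext k
      simp only [mem_filter]
      exact ⟨fun h => h.2, fun h => ⟨(mem_filter.1 h).1, h⟩⟩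
    rw [hsplit, hf1]
    have h1 : ∑ k ∈ Pv, q k = 2 * Pv.card := by
      rw [mul_comm, card_eq_sum_ones, sum_mul]
      refine sum_congr rfl fun k hk => ?_
      have hkF := (mem_filter.1 hk).1
      have hkg₀ : k ≠ g₀ := fun h => hg₀J (h ▸ hFJ hkF)
      have hkN : k ∉ B.N.erase e := fun h => (mem_sdiff.1 hkF).2 (mem_of_mem_erase h)
      have hko : k ≠ o := fun h => hoJ (h ▸ hFJ hkF)
      show (if k = o then 2 else if k = g₀ then 2 else if k ∈ B.N.erase e then 2 else if k ∈ Pv then 2 else 1) = 1 * 2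
      rw [if_neg hko, if_neg hkg₀, if_neg hkN, if_pos hk, one_mul]
    have h2 : ∑ k ∈ F.filter (fun k => k ∉ Pv), q k = (F.filter (fun k => k ∉ Pv)).card := by
      rw [card_eq_sum_ones]
      refine sum_congr rfl fun k hk => ?_
      obtain ⟨hkF, hkP⟩ := mem_filter.1 hk
      have hkg₀ : k ≠ g₀ := fun h => hg₀J (h ▸ hFJ hkF)
      have hkN : k ∉ B.N.erase e := fun h => (mem_sdiff.1 hkF).2 (mem_of_mem_erase h)
      have hko : k ≠ o := fun h => hoJ (h ▸ hFJ hkF)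
      show (if k = o then 2 else if k = g₀ then 2 else if k ∈ B.N.erase e then 2 else if k ∈ Pv then 2 else 1) = 1
      rw [if_neg hko, if_neg hkg₀, if_neg hkN, if_neg hkP]
    rw [h1, h2]
    have hc := card_filter_add_card_filter_not (s := F) (fun k => k ∈ Pv)
    rw [hf1] at hc
    omega
  have hqo : q o = 2 := by
    show (if o = o then 2 else if o = g₀ then 2 else if o ∈ B.N.erase e then 2 else if o ∈ Pv then 2 else 1) = 2
    rw [if_pos rfl]
  have hsumX : ∑ k ∈ X, q k = 2 + (2 + ((1 + 2 * (B.N.erase e).card) + (F.card + Pv.card))) := by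
    rw [hXdef, sum_insert hog₀J, sum_insert hg₀J, hqo, hqg₀, hJsplit, sum_union hdisj, hsumN, hsumF]
  have hexp := hB X hXr
  rw [hXcard] at hexp
  rw [hsumX, card_erase_of_mem he] at hbd
  have hJcard : B.J₀.card = B.N.card + F.card := by rw [hJsplit, card_union_of_disjoint hdisj]
  have hNpos : 1 ≤ B.N.card := card_pos.2 ⟨e, he⟩
  omega

end Summit.PneNP.PneNP.Theorems.PstarGateBudgetCross
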